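import Literature.RepresentationTheory.Unitary.InvariantSubspaceBicommutant
import Literature.NumberTheory.Automorphic.HilbertRepIsotypicComponent
import HarnessLib

/-!
# Bridge: unbundled unitary representations `R : G →* (H →L[ℂ] H)` versus Mathlib's `ContRepresentation`
(Dixmier, *C\*-algebras* (1977), §13.1: unitary representations, closed invariant subspaces)

Topic `RepresentationTheory/Unitary`; namespace `Literature.RepresentationTheory.Unitary`. The tree
carries TWO vocabularies for a unitary representation of a group `G` on a complex Hilbert space
`H`:

* the UNBUNDLED one of `InvariantSubspaceBicommutant` — a bare homomorphism
  `R : G →* (H →L[ℂ] H)` with `IsUnitaryRep R` ("`R g` preserves the inner product") and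
  `Invariant (Set.range R) M` for a submodule `M`;
* the BUNDLED one of `Literature/NumberTheory/Automorphic/HilbertRep*` — Mathlib's
  `ContRepresentation ℂ G H` with `ContRepresentation.IsUnitary` ("`π g ∈ unitary`"),
  `ContRepresentation.ClosedSubrep π`, `IsTopIrreducible`, `AreUnitarilyEquivalent`,
  `isotypicComponent`, ….

Mathlib's `ContRepresentation R G V` IS a structure with the single field
`toMonoidHom : G →* (V →L[R] V)` (constructor `ContRepresentation.ofMonoidHom`), so the passage is
definitional; this file records it once so that files written in either vocabulary can use the
other's theorems without re-proving them.

* `ofMonoidHom_apply` — `ContRepresentation.ofMonoidHom R g = R g` (`rfl`).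
* `isUnitaryRep_iff_isUnitary_ofMonoidHom`, `isUnitaryRep_toMonoidHom_iff` — `IsUnitaryRep R`
  is `(ContRepresentation.ofMonoidHom R).IsUnitary`, and `IsUnitaryRep π.toMonoidHom` is
  `π.IsUnitary` (via `ContRepresentation.isUnitary_iff_inner_map_map`: on a complete space an
  inner-product-preserving invertible operator is unitary).
* `closedSubrep` — a closed `Invariant (Set.range R)` submodule as a
  `ClosedSubrep (ContRepresentation.ofMonoidHom R)` (`ClosedSubrep.ofSubmodule`), with
  `toSubmodule_closedSubrep` / `mem_closedSubrep_iff` (`rfl`); conversely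
  `invariant_range_toSubmodule`, `isClosed_toSubmodule`: the submodule underlying a
  `ClosedSubrep` is closed and `Invariant (Set.range R)`.
* `toSubmodule_orthogonal_closedSubrep` — under the bridge the bundled orthogonal complement
  `ClosedSubrep.orthogonal` is `Mᗮ` (`rfl`), matching `invariant_orthogonal`.

## Mathlib

`ContRepresentation.ofMonoidHom` / `toMonoidHom` (Mathlib `RepresentationTheory/Continuous/Basic`).
No Mathlib declaration is duplicated.

## Design notes

* Everything is `rfl` / a one-line transport; the only mathematical input is
  `ContRepresentation.isUnitary_iff_inner_map_map` (tree).
* Provenance. Written under the LEAN-IN-TREE rule (2026-08-18) for the pub-hodgecm formalisation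
  cell: the cell's package states its representation theory over bare homomorphisms
  `R : G →* (H →L[ℂ] H)` (`HodgeCM.PerL34.Spectral.IsUnitaryRep`, reproduced in the tree as
  `InvariantSubspaceBicommutant`), while its generic decomposition layer was re-proved in the tree
  over `ContRepresentation` (`HilbertRepIsotypicComponent`, `HilbertRepIsotypicSubrepresentations`,
  `HilbertRepMatrixCoefficients`, `HilbertRepCyclicVectors`); this file is the adapter between the
  two. Nothing here is a claim of the adjudicated manuscripts.

## References

* J. Dixmier, *C\*-algebras*, North-Holland (1977), §13.1.1–13.1.2 [Dixmier1977].
-/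

set_option autoImplicit false

noncomputable section

open scoped InnerProductSpace

namespace Literature.RepresentationTheory.Unitary

variable {G H : Type*} [Group G] [NormedAddCommGroup H] [InnerProductSpace ℂ H]

/-! ### The representation -/

/-- The bundled representation of a bare homomorphism applies as the homomorphism (`rfl`).
[folklore] -/
@[simp]
theorem ofMonoidHom_apply (R : G →* (H →L[ℂ] H)) (g : G) :
    (ContRepresentation.ofMonoidHom R : ContRepresentation ℂ G H) g = R g :=
  rfl

/-- … and the homomorphism underlying a bundled representation applies as the representation
(`rfl`; Mathlib `ContRepresentation.toMonoidHom_apply`). [folklore] -/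
theorem toMonoidHom_apply' (π : ContRepresentation ℂ G H) (g : G) : π.toMonoidHom g = π g :=
  rfl

/-- Round trip (`rfl`). [folklore] -/
@[simp]
theorem toMonoidHom_ofMonoidHom (R : G →* (H →L[ℂ] H)) :
    (ContRepresentation.ofMonoidHom R : ContRepresentation ℂ G H).toMonoidHom = R :=
  rfl

/-! ### Unitarity -/

section Unitary

variable [CompleteSpace H]

/-- **`IsUnitaryRep R ↔ (ContRepresentation.ofMonoidHom R).IsUnitary`**: preserving all inner
products is membership of every `R g` in the unitary group (each `R g` is invertible;
`ContRepresentation.isUnitary_iff_inner_map_map`; Dixmier (1977), §13.1.1). [cite: Dixmier1977, §13.1.1] -/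
theorem isUnitaryRep_iff_isUnitary_ofMonoidHom (R : G →* (H →L[ℂ] H)) :
    IsUnitaryRep R ↔ (ContRepresentation.ofMonoidHom R : ContRepresentation ℂ G H).IsUnitary :=
  (ContRepresentation.isUnitary_iff_inner_map_map
    (π := (ContRepresentation.ofMonoidHom R : ContRepresentation ℂ G H))).symm

/-- **`IsUnitaryRep π.toMonoidHom ↔ π.IsUnitary`** for a bundled `π` (Dixmier (1977), §13.1.1).
[cite: Dixmier1977, §13.1.1] -/
theorem isUnitaryRep_toMonoidHom_iff (π : ContRepresentation ℂ G H) :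
    IsUnitaryRep π.toMonoidHom ↔ π.IsUnitary :=
  (ContRepresentation.isUnitary_iff_inner_map_map (π := π)).symm

/-- Transport of unitarity to the bundled side. [folklore] -/
theorem IsUnitaryRep.isUnitary_ofMonoidHom {R : G →* (H →L[ℂ] H)} (hR : IsUnitaryRep R) :
    (ContRepresentation.ofMonoidHom R : ContRepresentation ℂ G H).IsUnitary :=
  (isUnitaryRep_iff_isUnitary_ofMonoidHom R).mp hR

/-- Transport of unitarity to the unbundled side. [folklore] -/
theorem _root_.ContRepresentation.IsUnitary.isUnitaryRep_toMonoidHom {π : ContRepresentation ℂ G H}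
    (hπ : π.IsUnitary) : IsUnitaryRep π.toMonoidHom :=
  (isUnitaryRep_toMonoidHom_iff π).mpr hπ

end Unitary

/-! ### Closed invariant subspaces -/

/-- A closed `R(G)`-invariant submodule as a closed subrepresentation of the bundled
representation (Dixmier (1977), §13.1.2). [cite: Dixmier1977, §13.1.2] -/
def closedSubrep (R : G →* (H →L[ℂ] H)) (M : Submodule ℂ H) (hMc : IsClosed (M : Set H))
    (hM : Invariant (Set.range R) M) :
    ContRepresentation.ClosedSubrep (ContRepresentation.ofMonoidHom R : ContRepresentation ℂ G H) :=
  ContRepresentation.ClosedSubrep.ofSubmodule M hMc fun g v hv => invariant_range_iff.mp hM g v hv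

/-- The submodule underlying `closedSubrep R M _ _` is `M` (`rfl`). [folklore] -/
@[simp]
theorem toSubmodule_closedSubrep (R : G →* (H →L[ℂ] H)) (M : Submodule ℂ H)
    (hMc : IsClosed (M : Set H)) (hM : Invariant (Set.range R) M) :
    (closedSubrep R M hMc hM).toSubmodule = M :=
  rfl

/-- Membership in `closedSubrep R M _ _` is membership in `M` (`rfl`). [folklore] -/
@[simp]
theorem mem_closedSubrep_iff (R : G →* (H →L[ℂ] H)) (M : Submodule ℂ H)
    (hMc : IsClosed (M : Set H)) (hM : Invariant (Set.range R) M) (v : H) :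
    v ∈ closedSubrep R M hMc hM ↔ v ∈ M :=
  Iff.rfl

/-- Conversely, the submodule underlying a closed subrepresentation of the bundled representation
is `R(G)`-invariant … [folklore] -/
theorem invariant_range_toSubmodule {R : G →* (H →L[ℂ] H)}
    (W : ContRepresentation.ClosedSubrep (ContRepresentation.ofMonoidHom R : ContRepresentation ℂ G H)) :
    Invariant (Set.range R) W.toSubmodule :=
  invariant_range_iff.mpr fun g _ hv => W.apply_mem g hv

/-- … for any bundled `π`, in terms of `π.toMonoidHom` … [folklore] -/
theorem invariant_range_toMonoidHom_toSubmodule {π : ContRepresentation ℂ G H}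
    (W : ContRepresentation.ClosedSubrep π) : Invariant (Set.range π.toMonoidHom) W.toSubmodule :=
  invariant_range_iff.mpr fun g _ hv => W.apply_mem g hv

/-- … and closed. [folklore] -/
theorem isClosed_toSubmodule {π : ContRepresentation ℂ G H} (W : ContRepresentation.ClosedSubrep π) :
    IsClosed (W.toSubmodule : Set H) :=
  W.isClosed

/-- Round trip: the closed subrepresentation rebuilt from the submodule underlying `W` is `W`.
[folklore] -/
theorem closedSubrep_toSubmodule {R : G →* (H →L[ℂ] H)}
    (W : ContRepresentation.ClosedSubrep (ContRepresentation.ofMonoidHom R : ContRepresentation ℂ G H)) :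
    closedSubrep R W.toSubmodule W.isClosed (invariant_range_toSubmodule W) = W :=
  ContRepresentation.ClosedSubrep.ext fun _ => Iff.rfl

/-- Under the bridge the bundled orthogonal complement is `Mᗮ` (`rfl`), matching
`invariant_orthogonal` on the unbundled side (Dixmier (1977), §13.1.2). [cite: Dixmier1977, §13.1.2] -/
theorem toSubmodule_orthogonal_closedSubrep [CompleteSpace H] {R : G →* (H →L[ℂ] H)}
    (hR : IsUnitaryRep R) (M : Submodule ℂ H) (hMc : IsClosed (M : Set H))
    (hM : Invariant (Set.range R) M) :
    ((closedSubrep R M hMc hM).orthogonal hR.isUnitary_ofMonoidHom).toSubmodule = Mᗮ :=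
  rfl

end Literature.RepresentationTheory.Unitary

end
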